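import Literature.MathematicalPhysics.QuantumFieldTheory.Balaban1983to89.B5Eq129CoshSupersolution
import Literature.MathematicalPhysics.QuantumFieldTheory.Balaban1983to89.B9Eq342CoshWeightBlockDistance

/-!
# `Balaban1983to89.B9Eq342CoshWeightSite` — T. Bałaban, *Propagators for lattice gauge theories in a background field*, Commun. Math. Phys. **99** (1985)
# 389–434 [Balaban1985BackgroundPropagators] Thm 3.1 (3.42) p. 397 (the decay factor `e^{−δ₀d(y,y′)}`), (3.1)∕(3.3) pp. 390–391, (3.49) p. 399, with
# *Propagators and renormalization transformations … I*, Commun. Math. Phys. **95** (1984) 17–40 [Balaban1984PropagatorsI] p. 36: **(W) — THE AGMON `cosh`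
# WEIGHT OF STOREY (D) READ ON THE CHAIN's PERIODIC LATTICE `TSite d P` (steps `shift`∕`unshift`): centred at a fine site `x₀`,
# `W_{x₀}(x) = Π_μ cosh(a·dist(x₀,μ − x_μ, P_μℤ))` is POSITIVE, `= 1` AT THE CENTRE, a SUPERSOLUTION `(m − 2d·t²(cosh a − 1))·W ≤ (L₀ + m)W` of the flat
# `t²`-stencil in the `Sum.elim unshift shift` graph form, and DOMINATES THE BLOCK DISTANCE `e^{aL·d_m(πx₀,πx)} ≤ 2e^{a(L−1)}·W_{x₀}(x)` on `T_{L·m}`; a rate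
# `0 < a ≤ 1` with `m∕2 ≤ m − 2d·t²(cosh a − 1)` EXISTS for every `t`, `m > 0`** — the four weight binders `hW0`, `hx₀`, `hsup`, `hWd` of the (D-A) assembly
# `B9Eq342GreenPrimeSupBoundDecay.norm_GpOfU_apply_le_decay ∕ _rowSum` INHABITED (NE9 owner's SUP-NORM PROGRAMME, plan v10 §5 (D-MP)∕(D-A))

statement-level skeleton of published theorems with citation tags; proofs where landed; nothing here is a claim about the Yang–Mills mass gap

CITATION HEADER (lean-in-tree rule).  Audit cell `pub-balaban`, sub-cell `t4`, BINDER row NE9; filed by the row OWNER lineage `b2b-balaban-t4-ne9-p1` (gen 90).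
Sources READ first-hand in the held text layer [Balaban1985BackgroundPropagators] (`paper:balaban1985-cmp99-background-propagators`): p. 397 Thm 3.1 (3.42)
*«… ≤ B₀ e^{−δ₀d(y,y′)} for x ∈ Δ(y), y ∈ Λ_j, supp λ ⊂ Δ(y′)»*, p. 390 (3.1) (the periodic lattice `T_η`), p. 399 (3.49) (unit blocks); the weight is the
textbook Agmon∕Combes–Thomas supersolution device (METHOD only; P. D. Hislop, I. M. Sigal, *Introduction to Spectral Theory*, Ch. 3), typed on b05's torus
`Tor P` by this lineage's `B5Eq129CoshSupersolution` (gen 89) and compared with block distances by ne9-leaf-06 g70's `B9Eq342CoshWeightBlockDistance`; this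
file only TRANSPORTS it along the site dictionary `x ↦ (x_μ mod P_μ)_μ : TSite d P → Tor P` (the unit steps agree: `B9Eq315FlatDictionary.torCast_shift ∕
torCast_unshift`, re-derived here in three lines each from `B9SectCLatticeCarrier.shift_apply_val ∕ unshift_apply_val`).  NOTHING printed is used as a
hypothesis; the `[cite: …]` tags are TEXT LOCATIONS; every statement is `[folklore]` (ABSOLUTE RULE).

WHAT IS PROVED (sorry-free; 0 `def`; the weight is written out as the explicit product, no definition).  `P : Fin d → ℕ` positive, `a t m : ℝ`, centre `x₀`.
* §0 `cast_bijective`, `cast_shift`, `cast_unshift` — the site dictionary `TSite d P → Tor P` (re-derived: `B9Eq315FlatDictionary`'s twins, by name there).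
* §1 `weight_site_pos` (`0 < W_{x₀}(x)`), `weight_site_centre` (`W_{x₀}(x₀) = 1`), **`weight_site_supersolution`** (`(m − 2d·t²(cosh a − 1))·W_{x₀}(x) ≤
  Σ_{j : Fin d ⊕ Fin d} t²(W_{x₀}(x) − W_{x₀}(nbr(x,j))) + m·W_{x₀}(x)`, `nbr = Sum.elim (unshift · x) (shift · x)` — LITERALLY the binder `hsup` of the (D-A)
  assembly at `t = η⁻¹`, `m = 1`).
* §2 (private `half_le_rate`, `cosh_sub_one_le_sq`), **`exists_rate`** (`∃ a, 0 < a ≤ 1 ∧ m∕2 ≤ m − 2d·t²(cosh a − 1)` for `0 < m`: `cosh a − 1 ≤ a²` on `[0,1]` by `Real.cosh_le_exp_half_sq` +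
  `Real.abs_exp_sub_one_le`).
* §3 on `T_{L·m}`: **`exp_blockDist_le_weight_site`** (`e^{aL·d_m(πx₀,πx)} ≤ (e^{a(L−1)}·2)·W_{x₀}(x)`, `0 ≤ a` — the binder `hWd` with `κ₁ = aL`,
  `M = 2e^{a(L−1)}`, by ne9-leaf-06's `exp_blockDist_le_weight_of_prod_cosh` + `prod_cosh_torCast_eq`).
HONEST SCOPE.  Distance∕stencil bookkeeping for one explicit weight; no operator of the paper; nothing of [B9] Thm 3.1 asserted or valued.  NOT summit progress
(cell pub-balaban: NE9 NOT PRINTED ∕ NOT PROVED; «NE9 ⇐ the named binders»; row WALLED ON A MODEL (O-NE9-1; #5 UNRULED); spine PROVED 0∕9; rung (B)+1 finite T⁴ —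
NOT infinite volume, NOT mass gap, NOT BetaPertH, NOT Clay).  HONEST DEPENDENCY (cell line): continuum YM on T⁴ ⇐ BetaPertH ∧ nine spine estimates (0/9 proved);
BetaPertH ⇐ (D1) ∧ (D4) ∧ CAP+tail; G-an2-4 gates asym, D1 and NE2/3/4.  NEW file importing `B5Eq129CoshSupersolution` + `B9Eq342CoshWeightBlockDistance`; nothing
modified.  Net new unproved facts: 0.
-/

noncomputable section

open scoped BigOperators

namespace Literature.MathematicalPhysics.QuantumFieldTheory.Balaban1983to89.B9Eq342CoshWeightSite

open B4Sect5Torus (TSite tdist ccoord)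
open B9SectCLatticeCarrier (shift unshift shift_apply_val shift_apply_ne unshift_apply_val unshift_apply_ne)
open B5Prop11Plancherel (Tor unitVec)
open B4TorusKernel.MultiPeriod (circAbs)
open B9Eq319QprimeTorus (fineP blockCoord)
open B5Eq129CoshSupersolution (weight_supersolution weight_pos weight_factor_centre)
open B9Eq342CoshWeightBlockDistance (prod_cosh_torCast_eq exp_blockDist_le_weight_of_prod_cosh)

variable {d : ℕ} (P : Fin d → ℕ) [hP : ∀ i, NeZero (P i)]

/-! ## §0 The site dictionary `x ↦ (x_μ mod P_μ)_μ : TSite d P → Tor P`: bijective, and the unit steps agree -/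

/-- **THE SITE DICTIONARY IS A BIJECTION** `TSite d P → Tor P`, `x ↦ (x_μ mod P_μ)_μ` (cf. `B9Eq315FlatDictionary.torCast_bijective`; inverse
`z ↦ (z_μ.val)_μ`). [folklore] [cite: Balaban1985BackgroundPropagators, (3.1) p.390; Balaban1984PropagatorsI, (1.21) p.21] -/
theorem cast_bijective : Function.Bijective (fun x : TSite d P => fun μ => ((x μ : ℕ) : ZMod (P μ))) := by
  refine ⟨fun x y h => ?_, fun z => ⟨fun μ => ⟨(z μ).val, ZMod.val_lt (z μ)⟩, ?_⟩⟩
  · funext μ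
    have hμ := congrFun h μ
    have hv := congrArg ZMod.val hμ
    simp only [ZMod.val_natCast, Nat.mod_eq_of_lt (x μ).isLt, Nat.mod_eq_of_lt (y μ).isLt] at hv
    exact Fin.ext hv
  · funext μ
    exact ZMod.natCast_zmod_val (z μ)

omit hP in
/-- **THE FORWARD STEP AGREES**: `shift κ x ↦ (x mod P) + e_κ` (cf. `B9Eq315FlatDictionary.torCast_shift`). [folklore]
[cite: Balaban1985BackgroundPropagators, (3.3) p.390] -/
theorem cast_shift (κ : Fin d) (x : TSite d P) :
    (fun ν => ((shift κ x ν : ℕ) : ZMod (P ν))) = (fun ν => ((x ν : ℕ) : ZMod (P ν))) + unitVec P κ := by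
  funext ν
  rw [Pi.add_apply, unitVec]
  by_cases h : ν = κ
  · subst h
    rw [Pi.single_eq_same, show ((shift ν x ν : ℕ)) = (shift ν x ν).val from rfl, shift_apply_val, ZMod.natCast_mod, Nat.cast_add, Nat.cast_one]
  · rw [Pi.single_eq_of_ne h, shift_apply_ne h, add_zero]

/-- **THE BACKWARD STEP AGREES**: `unshift κ x ↦ (x mod P) − e_κ` (cf. `B9Eq315FlatDictionary.torCast_unshift`). [folklore]
[cite: Balaban1985BackgroundPropagators, (3.8) p.392] -/
theorem cast_unshift (κ : Fin d) (x : TSite d P) :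
    (fun ν => ((unshift κ x ν : ℕ) : ZMod (P ν))) = (fun ν => ((x ν : ℕ) : ZMod (P ν))) - unitVec P κ := by
  funext ν
  rw [Pi.sub_apply, unitVec]
  by_cases h : ν = κ
  · subst h
    have h1 : 1 ≤ P ν := Nat.one_le_iff_ne_zero.2 (NeZero.ne (P ν))
    rw [Pi.single_eq_same, show ((unshift ν x ν : ℕ)) = (unshift ν x ν).val from rfl, unshift_apply_val, ZMod.natCast_mod, Nat.cast_add,
      eq_sub_iff_add_eq, add_assoc, ← Nat.cast_add_one, Nat.sub_add_cancel h1, ZMod.natCast_self, add_zero]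
  · rw [Pi.single_eq_of_ne h, unshift_apply_ne h, sub_zero]

/-! ## §1 The weight centred at a fine site: positivity, normalisation, supersolution in the `Sum.elim unshift shift` graph form -/

omit hP in
/-- **`0 < W_{x₀}(x)`**. [folklore] [cite: Balaban1984PropagatorsI, p.36] -/
theorem weight_site_pos (a : ℝ) (x₀ x : TSite d P) :
    0 < ∏ μ, Real.cosh (a * (circAbs (P μ) (((((x₀ μ : ℕ) : ZMod (P μ)) - ((x μ : ℕ) : ZMod (P μ))).val : ℕ) : ℤ) : ℝ)) :=
  weight_pos P a (fun μ => ((x₀ μ : ℕ) : ZMod (P μ))) (fun μ => ((x μ : ℕ) : ZMod (P μ)))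

omit hP in
/-- **`W_{x₀}(x₀) = 1`** (every factor is `cosh 0`) — the binder `hx₀` of the (D-A) assembly. [folklore] [cite: Balaban1984PropagatorsI, p.36] -/
theorem weight_site_centre (a : ℝ) (x₀ : TSite d P) :
    ∏ μ, Real.cosh (a * (circAbs (P μ) (((((x₀ μ : ℕ) : ZMod (P μ)) - ((x₀ μ : ℕ) : ZMod (P μ))).val : ℕ) : ℤ) : ℝ)) = 1 :=
  Finset.prod_eq_one fun μ _ => weight_factor_centre P a (fun μ => ((x₀ μ : ℕ) : ZMod (P μ))) μ

/-- **THE WEIGHT IS A SUPERSOLUTION ON `TSite d P` IN THE GRAPH FORM OF THE BOOTSTRAP**: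
`(m − 2d·t²(cosh a − 1))·W_{x₀}(x) ≤ Σ_{j : Fin d ⊕ Fin d} t²·(W_{x₀}(x) − W_{x₀}(nbr(x,j))) + m·W_{x₀}(x)`, `nbr(x,·) = Sum.elim (unshift · x) (shift · x)` —
`B5Eq129CoshSupersolution.weight_supersolution` transported along the site dictionary (the unit steps agree) and re-bracketed; LITERALLY the binder `hsup`
of `B9Eq342GreenPrimeSupBoundDecay.norm_GpOfU_apply_le_decay` at `t = η⁻¹`, `m = 1`, `λ = 1 − 2d·η⁻²(cosh a − 1)`.
[cite: Balaban1984PropagatorsI, (1.29) p.23, p.36; Balaban1985BackgroundPropagators, (3.23) p.394, Thm 3.1 (3.42) p.397] -/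
theorem weight_site_supersolution (a t m : ℝ) (x₀ x : TSite d P) :
    (m - 2 * d * t ^ 2 * (Real.cosh a - 1)) *
        ∏ μ, Real.cosh (a * (circAbs (P μ) (((((x₀ μ : ℕ) : ZMod (P μ)) - ((x μ : ℕ) : ZMod (P μ))).val : ℕ) : ℤ) : ℝ)) ≤
      ∑ j : Fin d ⊕ Fin d, t ^ 2 *
          (∏ μ, Real.cosh (a * (circAbs (P μ) (((((x₀ μ : ℕ) : ZMod (P μ)) - ((x μ : ℕ) : ZMod (P μ))).val : ℕ) : ℤ) : ℝ)) -
            ∏ μ, Real.cosh (a * (circAbs (P μ) (((((x₀ μ : ℕ) : ZMod (P μ)) -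
              (((Sum.elim (fun ν => unshift ν x) (fun ν => shift ν x) j : TSite d P) μ : ℕ) : ZMod (P μ))).val : ℕ) : ℤ) : ℝ))) +
        m * ∏ μ, Real.cosh (a * (circAbs (P μ) (((((x₀ μ : ℕ) : ZMod (P μ)) - ((x μ : ℕ) : ZMod (P μ))).val : ℕ) : ℤ) : ℝ)) := by
  have h := weight_supersolution P a t m (fun μ => ((x₀ μ : ℕ) : ZMod (P μ))) (fun μ => ((x μ : ℕ) : ZMod (P μ)))
  -- the unit steps agree with the dictionary
  have hs : ∀ ν μ, (((shift ν x μ : ℕ) : ZMod (P μ))) = ((fun μ => ((x μ : ℕ) : ZMod (P μ))) + unitVec P ν) μ := fun ν μ =>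
    congrFun (cast_shift P ν x) μ
  have hu : ∀ ν μ, (((unshift ν x μ : ℕ) : ZMod (P μ))) = ((fun μ => ((x μ : ℕ) : ZMod (P μ))) - unitVec P ν) μ := fun ν μ =>
    congrFun (cast_unshift P ν x) μ
  rw [Fintype.sum_sum_type, ← Finset.sum_add_distrib]
  simp only [Sum.elim_inl, Sum.elim_inr, hs, hu]
  refine h.trans (le_of_eq ?_)
  congr 1
  refine Finset.sum_congr rfl fun ν _ => ?_
  ring

/-! ## §2 The rate: `λ = m − 2d·t²(cosh a − 1) ≥ m∕2` for a small enough `a > 0` -/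

omit hP in
/-- bookkeeping: `2d·t²(cosh a − 1) ≤ m∕2 ⟹ m∕2 ≤ m − 2d·t²(cosh a − 1)` (private helper). [folklore] -/
private theorem half_le_rate {a t m : ℝ} (h : 2 * d * t ^ 2 * (Real.cosh a - 1) ≤ m / 2) : m / 2 ≤ m - 2 * d * t ^ 2 * (Real.cosh a - 1) := by
  linarith

omit hP in
/-- `cosh a − 1 ≤ a²` for `0 ≤ a ≤ 1` (`cosh a ≤ e^{a²∕2}`, `|e^s − 1| ≤ 2|s|` for `|s| ≤ 1`; private helper). [folklore] -/
private theorem cosh_sub_one_le_sq {a : ℝ} (ha0 : 0 ≤ a) (ha1 : a ≤ 1) : Real.cosh a - 1 ≤ a ^ 2 := by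
  have h1 : Real.cosh a ≤ Real.exp (a ^ 2 / 2) := Real.cosh_le_exp_half_sq a
  have hs : |a ^ 2 / 2| ≤ 1 := by
    rw [abs_of_nonneg (by positivity)]
    nlinarith
  have h2 : |Real.exp (a ^ 2 / 2) - 1| ≤ 2 * |a ^ 2 / 2| := Real.abs_exp_sub_one_le hs
  rw [abs_of_nonneg (by positivity : (0 : ℝ) ≤ a ^ 2 / 2)] at h2
  have h3 := (le_abs_self _).trans h2
  linarith

omit hP in
/-- **A RATE EXISTS**: for every `t` and `0 < m` there is `0 < a ≤ 1` with `m∕2 ≤ m − 2d·t²(cosh a − 1)` — so the supersolution constant `λ` of §1 is at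
least `m∕2` (at the diagonal `t = η⁻¹ = L`, `m = 1`: `λ ≥ 1∕2` with `a` depending on `d`, `L` only — print's «constants dependent on d and L only»).
[folklore] [cite: Balaban1985BackgroundPropagators, Thm 3.1 p.397; Balaban1984PropagatorsI, p.36] -/
theorem exists_rate (t m : ℝ) (hm : 0 < m) : ∃ a : ℝ, 0 < a ∧ a ≤ 1 ∧ m / 2 ≤ m - 2 * d * t ^ 2 * (Real.cosh a - 1) := by
  have hD : 0 < 8 * (d : ℝ) * t ^ 2 + 4 := by positivity
  refine ⟨min 1 (m / (8 * d * t ^ 2 + 4)), lt_min one_pos (div_pos hm hD), min_le_left _ _, half_le_rate ?_⟩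
  set a : ℝ := min 1 (m / (8 * d * t ^ 2 + 4)) with ha_def
  have ha0 : 0 ≤ a := (lt_min one_pos (div_pos hm hD)).le
  have ha1 : a ≤ 1 := min_le_left _ _
  have ha2 : a ≤ m / (8 * d * t ^ 2 + 4) := min_le_right _ _
  have hsq : a ^ 2 ≤ m / (8 * d * t ^ 2 + 4) := by nlinarith
  have hc : Real.cosh a - 1 ≤ m / (8 * d * t ^ 2 + 4) := (cosh_sub_one_le_sq ha0 ha1).trans hsq
  have hdt : 0 ≤ 2 * (d : ℝ) * t ^ 2 := by positivity
  calc 2 * d * t ^ 2 * (Real.cosh a - 1) ≤ 2 * d * t ^ 2 * (m / (8 * d * t ^ 2 + 4)) := mul_le_mul_of_nonneg_left hc hdt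
    _ = m / 2 * (4 * d * t ^ 2 / (8 * d * t ^ 2 + 4)) := by field_simp; ring
    _ ≤ m / 2 * 1 := mul_le_mul_of_nonneg_left (by rw [div_le_one hD]; linarith) (by linarith)
    _ = m / 2 := mul_one _

/-! ## §3 On `T_{L·m}`: the weight dominates the block-distance exponential (the binder `hWd`) -/

omit hP in
/-- bookkeeping: the fine periods `L·m_i` of [B7] (1)–(2) are positive (`L ≠ 0`, `1 ≤ m_i`) — the `NeZero` instances b05's `Tor (L·m)` needs (cf.
`B9Eq315QTower.instNeZeroFineP`, stated from `[∀ i, NeZero (m i)]`). [cite: Balaban1985Averaging, (1)–(2) p.17] -/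
theorem neZero_fineP (L : ℕ) [NeZero L] (m : Fin d → ℕ) (hm : ∀ i, 1 ≤ m i) : ∀ i, NeZero (fineP L m i) :=
  fun i => ⟨Nat.mul_ne_zero (NeZero.ne L) (by have := hm i; omega)⟩

/-- **`e^{aL·d_m(πx₀,πx)} ≤ (e^{a(L−1)}·2)·W_{x₀}(x)` on the fine torus `T_{L·m}`** (`0 ≤ a`, `1 ≤ m_i`) — the binder `hWd` of the (D-A) assembly with
`κ₁ = aL`, `M = 2e^{a(L−1)}` (ne9-leaf-06's `exp_blockDist_le_weight_of_prod_cosh` at `M_W = 1` after `prod_cosh_torCast_eq`).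
[cite: Balaban1985Averaging, (2) p.17; Balaban1984PropagatorsI, p.36; Balaban1985BackgroundPropagators, Thm 3.1 (3.42) p.397, (3.49) p.399] -/
theorem exp_blockDist_le_weight_site (L : ℕ) [NeZero L] (m : Fin d → ℕ) (hm : ∀ i, 1 ≤ m i) {a : ℝ} (ha : 0 ≤ a) (x₀ x : TSite d (fineP L m)) :
    Real.exp (a * (L : ℝ) * tdist m (blockCoord L m x₀) (blockCoord L m x)) ≤
      Real.exp (a * ((L : ℝ) - 1)) * 2 *
        ∏ μ, Real.cosh (a * (circAbs (fineP L m μ) (((((x₀ μ : ℕ) : ZMod (fineP L m μ)) - ((x μ : ℕ) : ZMod (fineP L m μ))).val : ℕ) : ℤ) : ℝ)) := by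
  haveI := neZero_fineP L m hm
  have h := exp_blockDist_le_weight_of_prod_cosh (L := L) (m := m) hm ha x₀ (MW := 1)
    (W := fun x => ∏ μ, Real.cosh (a * (circAbs (fineP L m μ) (((((x₀ μ : ℕ) : ZMod (fineP L m μ)) - ((x μ : ℕ) : ZMod (fineP L m μ))).val : ℕ) : ℤ) : ℝ)))
    (fun x => le_of_eq (by rw [one_mul, prod_cosh_torCast_eq a x₀ x])) x
  calc _ ≤ Real.exp (a * ((L : ℝ) - 1)) * (2 * 1) *
        ∏ μ, Real.cosh (a * (circAbs (fineP L m μ) (((((x₀ μ : ℕ) : ZMod (fineP L m μ)) - ((x μ : ℕ) : ZMod (fineP L m μ))).val : ℕ) : ℤ) : ℝ)) := h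
    _ = _ := by rw [mul_one]

/-- **THE FOUR WEIGHT BINDERS OF THE (D-A) ASSEMBLY AT THE CHAIN's LETTERS** (`t = η⁻¹`, `m = 1`, any `a ≥ 0`): with
`W = W_{x₀}` on `T_{L·m}`: `0 < W`, `W(x₀) = 1`, `(1 − 2d·η⁻²(cosh a − 1))·W ≤ Σ_j η⁻²(W − W∘nbr_j) + 1·W`, `e^{aL·d_m(πx₀,πx)} ≤ (e^{a(L−1)}·2)·W(x)`.
[cite: Balaban1985BackgroundPropagators, Thm 3.1 (3.42) p.397, (3.23) p.394, (3.49) p.399] -/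
theorem weight_site_letters (L : ℕ) [NeZero L] (m : Fin d → ℕ) (hm : ∀ i, 1 ≤ m i) (η : ℝ) {a : ℝ} (ha : 0 ≤ a) (x₀ : TSite d (fineP L m)) :
    (∀ x : TSite d (fineP L m),
        0 < ∏ μ, Real.cosh (a * (circAbs (fineP L m μ) (((((x₀ μ : ℕ) : ZMod (fineP L m μ)) - ((x μ : ℕ) : ZMod (fineP L m μ))).val : ℕ) : ℤ) : ℝ))) ∧
      (∏ μ, Real.cosh (a * (circAbs (fineP L m μ) (((((x₀ μ : ℕ) : ZMod (fineP L m μ)) - ((x₀ μ : ℕ) : ZMod (fineP L m μ))).val : ℕ) : ℤ) : ℝ)) = 1) ∧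
      (∀ x : TSite d (fineP L m), (1 - 2 * d * (η⁻¹) ^ 2 * (Real.cosh a - 1)) *
          ∏ μ, Real.cosh (a * (circAbs (fineP L m μ) (((((x₀ μ : ℕ) : ZMod (fineP L m μ)) - ((x μ : ℕ) : ZMod (fineP L m μ))).val : ℕ) : ℤ) : ℝ)) ≤
        ∑ j : Fin d ⊕ Fin d, (η⁻¹) ^ 2 *
            (∏ μ, Real.cosh (a * (circAbs (fineP L m μ) (((((x₀ μ : ℕ) : ZMod (fineP L m μ)) - ((x μ : ℕ) : ZMod (fineP L m μ))).val : ℕ) : ℤ) : ℝ)) -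
              ∏ μ, Real.cosh (a * (circAbs (fineP L m μ) (((((x₀ μ : ℕ) : ZMod (fineP L m μ)) -
                (((Sum.elim (fun ν => unshift ν x) (fun ν => shift ν x) j : TSite d (fineP L m)) μ : ℕ) : ZMod (fineP L m μ))).val : ℕ) : ℤ) : ℝ))) +
          1 * ∏ μ, Real.cosh (a * (circAbs (fineP L m μ) (((((x₀ μ : ℕ) : ZMod (fineP L m μ)) - ((x μ : ℕ) : ZMod (fineP L m μ))).val : ℕ) : ℤ) : ℝ))) ∧
      (∀ x : TSite d (fineP L m), Real.exp (a * (L : ℝ) * tdist m (blockCoord L m x₀) (blockCoord L m x)) ≤ Real.exp (a * ((L : ℝ) - 1)) * 2 *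
        ∏ μ, Real.cosh (a * (circAbs (fineP L m μ) (((((x₀ μ : ℕ) : ZMod (fineP L m μ)) - ((x μ : ℕ) : ZMod (fineP L m μ))).val : ℕ) : ℤ) : ℝ))) := by
  haveI := neZero_fineP L m hm
  exact ⟨fun x => weight_site_pos (fineP L m) a x₀ x, weight_site_centre (fineP L m) a x₀,
    fun x => weight_site_supersolution (fineP L m) a η⁻¹ 1 x₀ x, fun x => exp_blockDist_le_weight_site L m hm ha x₀ x⟩

end Literature.MathematicalPhysics.QuantumFieldTheory.Balaban1983to89.B9Eq342CoshWeightSite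

end
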